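import Summits.BirchSwinnertonDyer.Rank1Residual.GaloisImage.SupersingularInertiaCentralInvolution
import Summits.BirchSwinnertonDyer.Rank1Residual.GaloisImage.InflationRestrictionSakamotoH3
import Literature.NumberTheory.EllipticCurves.SerreOpenImageSupersingularAssemblyProofs
import HarnessLib

/-!
# `e_p = p² − 1` EXACTLY on the `(G) ∧ ss` rows, and Sakamoto's (H.3) at level one WITHOUT
# surjectivity — O8-TAME part 11b
# (cell `b2b-bsdres`, lane CLASS-CLOSURE, seat cc-typer-1 = typer of record N11 / O8, GEN 10; joint
# small-image axis O8 / N2 / N3; sub-partition key `e_p = #ρ̄_{E,p}(I_𝔓)` of O8/SUBPARTITION-typed;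
# sequel of `SupersingularInertiaCentralInvolution.lean` = part 11a)

HONEST FRAMING (cell `b2b-bsdres`, run/shared/lean/b2b/bsd-rank1-residual/, verbatim in every
file): the goal of the cell is to DELETE the COMBINATION-SHAPED residual classes of the
Birch–Swinnerton-Dyer formula for ALL analytic-rank `≤ 1` elliptic curves over `ℚ` — "full BSD
formula for every rank `≤ 1` curve in class `C`" assembled STRICTLY from published theorems — so
that the rank-`≤ 1` remainder becomes exactly the CONSTRUCTION-SHAPED classes, which are TYPED
(missing-input `Prop`s), NOT attempted. This is not "finishing BSD". THEOREMS ONLY: no definition,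
no named fact, no conjecture node, nothing booked, no label of `RESIDUAL-MAP.md` moved; census
counts are EVIDENCE, never a Literature fact.

## What this file does

GEN 9's `SmallImageNiveauTwoSupersingular.lean` left ONE column of the O8 sub-partition at the
divisibility level on the `(G) ∧ ss` rows: "`(p − 1) ∣ e_p ∤ p − 1`; NOT claimed: the exact value of
`e_p`". Part 11a supplies ONE `z ∈ I_𝔓` acting as `−1` on both `E[p]` and `E^{(d)}[p]`. Here:

* §3 **`card_map_galoisRepTorsion_eq_of_signed_addEquiv`** (transport) — along a signed isomorphism
  `t : W₁[p] ≃+ W₂[p]` (equivariant up to a `σ`-dependent sign), if ONE `z ∈ H` acts as `−1` on both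
  modules then `#ρ̄_{W₁,p}(H) = #ρ̄_{W₂,p}(H)`: conjugation by `t` is an injective homomorphism
  `Aut(W₁[p]) → Aut(W₂[p])` carrying `ρ̄₁(σ)` to `ρ̄₂(σ)` or to `ρ̄₂(zσ)`, so it maps `ρ̄₁(H)` ONTO
  `ρ̄₂(H)`. Then **`isCyclic_and_card_inertia_map_eq_sq_sub_one_of_goodSS`** (`ρ̄(I_𝔓)` cyclic of
  order `p² − 1` at EVERY `𝔓 ∣ p` for a good supersingular odd `p`; the tree's
  `isCyclic_and_card_inertia_map_of_dvd_frobeniusTrace` is the statement at the place's prime, moved by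
  `isCyclic_and_card_map_inertia_smul`) and **`card_inertia_map_eq_sq_sub_one_of_goodSS_twist`**: a
  good supersingular TWIST ⟹ `e_p(E) = p² − 1` EXACTLY — twisting by the ramified quadratic
  character does not change the order of the inertia image (`ρ̄_E|_{I_p} ≅ (ψ₂ ⊕ ψ₂^p) ⊗ χ_d`).
* §4 the census cell and O8: **`SubGss.card_inertia_map_eq_sq_sub_one`**,
  **`SubGss.exists_mem_inertia_smul_eq_neg`** (`p` odd, `E` additive at `p`, cc-typer-5's `SubGss W p`;
  twist datum SUPPLIED by `O5.exists_goodSS_twist_pStar_of_subGss`), the O8 forms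
  **`O8.card_inertia_map_eq_sq_sub_one_of_subGss`**, **`O8.exists_mem_inertia_smul_eq_neg_of_subGss`**
  (`ClassX4 W p ∧ SubGss W p`; no `¬ Surj` needed); and **`hH3_self_of_smul_eq_neg`** /
  **`SubGss.hH3_self`** / **`O8.hH3_self_of_subGss`** — Sakamoto's hypothesis (H.3) at LEVEL ONE
  (`T = T̄ = E[p]`: every continuous crossed homomorphism `Γ_ℚ → E[p]` vanishing on
  `ker ρ̄_{E,p} ∩ Gal(ℚ̄/ℚ(μ_p))` is principal) holds on EVERY `(G) ∧ ss` row at an odd `p`,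
  SURJECTIVE OR NOT — n1011-p04's `hH3_self_of_hasSurjectiveModNGaloisRep` used `ρ̄_{E,p}` onto only to
  find an element acting as `−1`; on these rows inertia supplies it.

So the column `e_p` of O8/SUBPARTITION-typed is theorem-level and EXACT on all three tame cells at
every odd `p`: (M), (G-ord) ⟹ `e_p = p − 1` (GEN 9 part 8); `(G) ∧ ss` ⟹ `e_p = p² − 1` (here).
NOT claimed: anything at `p = 2`; anything on the (t′) / wild rows; the level-`p^{k+1}` (H.3) of the
N11 instance for `k ≥ 1` (it stays on tower surjectivity); (H.1), (H.2), (H.4), the core rank; any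
class theorem of BSD type; no label moves.

References: [Serre1972] J.-P. Serre, Invent. Math. 15 (1972) §1.3 Prop. 1–2, §1.11 Prop. 12;
[SilvermanAEC2009] *AEC* X.5 Cor. 5.4; [NeukirchANT1999] Ch. I §9 (9.1), (9.4); [Sakamoto2024]
R. Sakamoto, JTNB 36 (2024) §2 (H.3); [MazurRubin2004] Lemma 3.5.2; C.-H. Sah, J. Algebra 10 (1968);
[Delbourgo1998] §1.5 (G).
-/

set_option autoImplicit false

noncomputable section

open scoped Classical NumberField Pointwise

open Field IsDedekindDomain NumberField WeierstrassCurve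
  Literature.NumberTheory.EllipticCurves Literature.NumberTheory.GaloisRepresentations
  Literature.NumberTheory.EllipticCurves.Rank1Residual Rat.HeightOneSpectrum
  Summit.BirchSwinnertonDyer.Rank1Residual.Additive

namespace Summit.BirchSwinnertonDyer.Rank1Residual.GaloisImage

/-! ## §3. The exact order: `e_p = p² − 1` at a good supersingular odd `p` and on its twists -/

section Order

variable {W₁ W₂ : WeierstrassCurve ℚ} {p : ℕ}

/-- **Transport of `#ρ̄(H)` along a signed isomorphism with a common `−1`.** If `t : W₁[p] ≃+ W₂[p]`
is `Γ_ℚ`-equivariant up to a `σ`-dependent sign and ONE `z ∈ H` acts as `−1` on both `W₁[p]` and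
`W₂[p]`, then `#ρ̄_{W₁,p}(H) = #ρ̄_{W₂,p}(H)`: conjugation by `t` (an injective homomorphism
`Aut(W₁[p]) → Aut(W₂[p])`) carries `ρ̄₁(σ)` to `ρ̄₂(σ)` or to `ρ̄₂(zσ)`, so it maps `ρ̄₁(H)` ONTO
`ρ̄₂(H)`. [cite: SilvermanAEC2009, X.5 Cor. 5.4] -/
theorem card_map_galoisRepTorsion_eq_of_signed_addEquiv (H : Subgroup (absoluteGaloisGroup ℚ))
    (t : geomTorsion W₁ (p : ℤ) ≃+ geomTorsion W₂ (p : ℤ))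
    (ht : ∀ σ : absoluteGaloisGroup ℚ,
      (∀ x, t (σ • x) = σ • t x) ∨ (∀ x, t (σ • x) = -(σ • t x)))
    {z : absoluteGaloisGroup ℚ} (hzH : z ∈ H) (hz₁ : ∀ P : geomTorsion W₁ (p : ℤ), z • P = -P)
    (hz₂ : ∀ P : geomTorsion W₂ (p : ℤ), z • P = -P) :
    Nat.card (H.map (galoisRepTorsion W₁ p)) = Nat.card (H.map (galoisRepTorsion W₂ p)) := by
  -- conjugation by `t`
  let c : Multiplicative (AddAut (geomTorsion W₁ (p : ℤ))) →*
      Multiplicative (AddAut (geomTorsion W₂ (p : ℤ))) :=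
    (AddEquiv.toMultiplicative (AddAut.congr t)).toMonoidHom
  have hc : Function.Injective c := (AddEquiv.toMultiplicative (AddAut.congr t)).injective
  have hcapp : ∀ (φ : Multiplicative (AddAut (geomTorsion W₁ (p : ℤ)))) (y : geomTorsion W₂ (p : ℤ)),
      (Multiplicative.toAdd (c φ)) y = t ((Multiplicative.toAdd φ) (t.symm y)) := fun _ _ ↦ rfl
  have heq : ∀ (φ : Multiplicative (AddAut (geomTorsion W₁ (p : ℤ)))) (σ' : absoluteGaloisGroup ℚ),
      (∀ y, t ((Multiplicative.toAdd φ) (t.symm y)) = σ' • y) →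
        c φ = galoisRepTorsion W₂ p σ' := by
    intro φ σ' h
    refine Multiplicative.toAdd.injective (AddEquiv.ext fun y ↦ ?_)
    rw [hcapp, galoisRepTorsion_apply, h]
  rw [← Subgroup.card_map_of_injective hc, Subgroup.map_map]
  suffices hmap : H.map (c.comp (galoisRepTorsion W₁ p)) = H.map (galoisRepTorsion W₂ p) by
    rw [hmap]
  ext φ
  simp only [Subgroup.mem_map, MonoidHom.coe_comp, Function.comp_apply]
  constructor
  · rintro ⟨σ, hσ, rfl⟩
    rcases ht σ with h | h
    · refine ⟨σ, hσ, (heq _ _ fun y ↦ ?_).symm⟩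
      rw [galoisRepTorsion_apply, h, t.apply_symm_apply]
    · refine ⟨z * σ, H.mul_mem hzH hσ, (heq _ _ fun y ↦ ?_).symm⟩
      rw [galoisRepTorsion_apply, h, t.apply_symm_apply, mul_smul, hz₂]
  · rintro ⟨σ, hσ, rfl⟩
    rcases ht σ with h | h
    · refine ⟨σ, hσ, heq _ _ fun y ↦ ?_⟩
      rw [galoisRepTorsion_apply, h, t.apply_symm_apply]
    · refine ⟨z * σ, H.mul_mem hzH hσ, heq _ _ fun y ↦ ?_⟩
      rw [galoisRepTorsion_apply, mul_smul, hz₁, map_neg, h, t.apply_symm_apply, neg_neg]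

variable {W : WeierstrassCurve ℚ} [W.IsElliptic] [W.IsGloballyMinimal] [hp : Fact p.Prime]

/-- **`e_p = p² − 1` (and `ρ̄(I_𝔓)` cyclic) at a good SUPERSINGULAR odd `p`, EVERY `𝔓 ∣ p`** —
Serre 1972 §1.11 Prop. 12 c). The tree's `isCyclic_and_card_inertia_map_of_dvd_frobeniusTrace` is the
statement at the place's prime; conjugation (`isCyclic_and_card_map_inertia_smul`) moves it.
[cite: Serre1972, §1.11 Prop. 12 c) and §1.3 Prop. 1–2] [cite: NeukirchANT1999, Ch. I §9 (9.4)] -/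
theorem isCyclic_and_card_inertia_map_eq_sq_sub_one_of_goodSS (hp2 : p ≠ 2) (hss : GoodSS W p)
    {v : HeightOneSpectrum (𝓞 ℚ)} (hv : ((p : ℕ) : 𝓞 ℚ) ∈ v.asIdeal)
    {𝔓 : Ideal (absIntegers (𝓞 ℚ) ℚ)} (h𝔓 : 𝔓 ∈ v.primesAbove) :
    IsCyclic ((𝔓.inertia (absoluteGaloisGroup ℚ)).map (galoisRepTorsion W p)) ∧
      Nat.card ((𝔓.inertia (absoluteGaloisGroup ℚ)).map (galoisRepTorsion W p)) = p ^ 2 - 1 := by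
  have hp' : p.Prime := hp.out
  have hvp : (primesEquiv v : ℕ) = p := by
    rw [(natCast_mem_asIdeal_iff_eq_primesEquiv_symm v hp').mp hv, Equiv.apply_symm_apply]
  obtain ⟨𝔓₀, hmem₀, h𝔓₀⟩ := exists_ideal_placeOver p hvp
  have hΔ : ¬ (p : ℤ) ∣ minimalDiscriminantInt W :=
    W.not_dvd_minimalDiscriminantInt_of_hasGoodReductionAtPrime' p hss.1
  have hT : ∀ π ζ : AlgebraicClosure ℚ, π ^ (p ^ 2 - 1) = p → ζ ^ (p ^ 2 - 1) = 1 →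
      ∃ s ∈ 𝔓₀.inertia (absoluteGaloisGroup ℚ), s • π = ζ * π := fun π ζ hπ hζ ↦
    exists_mem_inertia_smul_eq_mul_of_pow_eq p
      (Nat.sub_pos_of_lt (Nat.one_lt_pow two_ne_zero hp'.one_lt)) hvp h𝔓₀ hπ hζ
  have h0 := isCyclic_and_card_inertia_map_of_dvd_frobeniusTrace p hΔ hss.2 hp2 hmem₀ hT
  obtain ⟨g, hg⟩ :=
    HeightOneSpectrum.exists_smul_eq_of_mem_primesAbove_holds (K := ℚ) (v := v) h𝔓₀ h𝔓
  rw [← hg]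
  exact isCyclic_and_card_map_inertia_smul (galoisRepTorsion W p) g 𝔓₀ h0

/-- **`e_p = p² − 1` at a good supersingular odd `p`, every `𝔓 ∣ p`** (cardinality half).
[cite: Serre1972, §1.11 Prop. 12 c)] -/
theorem card_inertia_map_eq_sq_sub_one_of_goodSS (hp2 : p ≠ 2) (hss : GoodSS W p)
    {v : HeightOneSpectrum (𝓞 ℚ)} (hv : ((p : ℕ) : 𝓞 ℚ) ∈ v.asIdeal)
    {𝔓 : Ideal (absIntegers (𝓞 ℚ) ℚ)} (h𝔓 : 𝔓 ∈ v.primesAbove) :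
    Nat.card ((𝔓.inertia (absoluteGaloisGroup ℚ)).map (galoisRepTorsion W p)) = p ^ 2 - 1 :=
  (isCyclic_and_card_inertia_map_eq_sq_sub_one_of_goodSS hp2 hss hv h𝔓).2

omit [W.IsElliptic] [W.IsGloballyMinimal] in
/-- **A good supersingular TWIST ⟹ `e_p(E) = p² − 1` EXACTLY**, every `𝔓 ∣ p`: if some `ℚ`-model
`Wd` of `E^{(d)}` (`C • W.quadraticTwist d = Wd`, `d ≠ 0`, `Wd` globally minimal) has `GoodSS Wd p`,
`p ≠ 2`, then `#ρ̄_{E,p}(I_𝔓) = p² − 1`. (§2: one `z ∈ I_𝔓` is `−1` on both modules; §3 transport;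
`e_p(Wd) = p² − 1`.) This is the shape `ρ̄_E|_{I_p} = (ψ₂ ⊕ ψ₂^p) ⊗ χ_d` of the `(G) ∧ ss`, `e = 2`
rows: twisting by the quadratic ramified character does NOT change the order of the inertia image.
[cite: Serre1972, §1.11 Prop. 12 c)] [cite: SilvermanAEC2009, X.5 Cor. 5.4] -/
theorem card_inertia_map_eq_sq_sub_one_of_goodSS_twist (hp2 : p ≠ 2) {d : ℚ} (hd : d ≠ 0)
    (Wd : WeierstrassCurve ℚ) [Wd.IsElliptic] [Wd.IsGloballyMinimal]
    (hWd : ∃ C : VariableChange ℚ, C • W.quadraticTwist d = Wd) (hss : GoodSS Wd p)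
    {v : HeightOneSpectrum (𝓞 ℚ)} (hv : ((p : ℕ) : 𝓞 ℚ) ∈ v.asIdeal)
    {𝔓 : Ideal (absIntegers (𝓞 ℚ) ℚ)} (h𝔓 : 𝔓 ∈ v.primesAbove) :
    Nat.card ((𝔓.inertia (absoluteGaloisGroup ℚ)).map (galoisRepTorsion W p)) = p ^ 2 - 1 := by
  obtain ⟨z, hzI, hz₁, hz₂⟩ :=
    exists_mem_inertia_smul_eq_neg_of_goodSS_twist (V := W) hp2 hd Wd hWd hss hv h𝔓
  obtain ⟨t, ht⟩ := exists_torsion_addEquiv_signed_of_model_twist W p Wd hd hWd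
  rw [card_map_galoisRepTorsion_eq_of_signed_addEquiv _ t ht hzI hz₁ hz₂]
  exact card_inertia_map_eq_sq_sub_one_of_goodSS hp2 hss hv h𝔓

end Order

/-! ## §4. The census cell `(G) ∧ ss`, the O8 rows, and Sakamoto's (H.3) at level one -/

section Cell

variable (W : WeierstrassCurve ℚ) [W.IsElliptic] [W.IsGloballyMinimal] (p : ℕ) [hp : Fact p.Prime]

/-- **`(G) ∧ ss` ⟹ `−1 ∈ ρ̄_{E,p}(I_𝔓)`**, every `𝔓 ∣ p` (`p` odd, `E` additive at `p`, cc-typer-5's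
census cell `SubGss W p`; the twist datum `E^{(p*)}` good supersingular at `p` is SUPPLIED by
`O5.exists_goodSS_twist_pStar_of_subGss`). [cite: Serre1972, §1.11 Prop. 12]
[cite: Delbourgo1998, §1.5 (G)] [cite: SilvermanAEC2009, X.5 Cor. 5.4] -/
theorem SubGss.exists_mem_inertia_smul_eq_neg (hp2 : p ≠ 2) (hadd : Addv W p) (hG : SubGss W p)
    {v : HeightOneSpectrum (𝓞 ℚ)} (hv : ((p : ℕ) : 𝓞 ℚ) ∈ v.asIdeal)
    {𝔓 : Ideal (absIntegers (𝓞 ℚ) ℚ)} (h𝔓 : 𝔓 ∈ v.primesAbove) :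
    ∃ z ∈ 𝔓.inertia (absoluteGaloisGroup ℚ), ∀ P : geomTorsion W (p : ℤ), z • P = -P := by
  obtain ⟨Wd, hE, hM, C, hC, hss⟩ := O5.exists_goodSS_twist_pStar_of_subGss W p hp2 hadd hG
  obtain ⟨z, hzI, hz₁, -⟩ := exists_mem_inertia_smul_eq_neg_of_goodSS_twist (V := W) hp2
    (O5.pStar_ne_zero p) Wd ⟨C, hC⟩ hss hv h𝔓
  exact ⟨z, hzI, hz₁⟩

/-- **`(G) ∧ ss` ⟹ `e_p = p² − 1` EXACTLY**, every `𝔓 ∣ p` (`p` odd, `E` additive at `p`,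
`SubGss W p`). [cite: Serre1972, §1.11 Prop. 12 c)] [cite: Delbourgo1998, §1.5 (G)]
[cite: SilvermanAEC2009, X.5 Cor. 5.4] -/
theorem SubGss.card_inertia_map_eq_sq_sub_one (hp2 : p ≠ 2) (hadd : Addv W p) (hG : SubGss W p)
    {v : HeightOneSpectrum (𝓞 ℚ)} (hv : ((p : ℕ) : 𝓞 ℚ) ∈ v.asIdeal)
    {𝔓 : Ideal (absIntegers (𝓞 ℚ) ℚ)} (h𝔓 : 𝔓 ∈ v.primesAbove) :
    Nat.card ((𝔓.inertia (absoluteGaloisGroup ℚ)).map (galoisRepTorsion W p)) = p ^ 2 - 1 := by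
  obtain ⟨Wd, hE, hM, C, hC, hss⟩ := O5.exists_goodSS_twist_pStar_of_subGss W p hp2 hadd hG
  exact card_inertia_map_eq_sq_sub_one_of_goodSS_twist hp2 (O5.pStar_ne_zero p) Wd ⟨C, hC⟩ hss hv h𝔓

/-- **O8 ∩ (G) ∧ ss: `−1 ∈ ρ̄_{E,p}(I_𝔓)`** on an O8 row (`ClassX4 W p`: `p` odd, additive, `E[p]`
irreducible) in the census cell `(G) ∧ ss`, at every `𝔓 ∣ p` (no `¬ Surj` needed). On the other two
tame cells ((M), (G-ord): `e_p = p − 1`, GEN 9) this FAILS in general (`−1 ∉ ρ̄(I_𝔓)` when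
`p ≡ 1 (mod 4)`), so the central involution in INERTIA is specific to the supersingular cell.
[cite: Serre1972, §1.11 Prop. 12] [cite: Delbourgo1998, §1.5 (G)] -/
theorem O8.exists_mem_inertia_smul_eq_neg_of_subGss (hX : ClassX4 W p) (hG : SubGss W p)
    {v : HeightOneSpectrum (𝓞 ℚ)} (hv : ((p : ℕ) : 𝓞 ℚ) ∈ v.asIdeal)
    {𝔓 : Ideal (absIntegers (𝓞 ℚ) ℚ)} (h𝔓 : 𝔓 ∈ v.primesAbove) :
    ∃ z ∈ 𝔓.inertia (absoluteGaloisGroup ℚ), ∀ P : geomTorsion W (p : ℤ), z • P = -P :=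
  SubGss.exists_mem_inertia_smul_eq_neg W p hX.1 hX.2.1 hG hv h𝔓

/-- **O8 ∩ (G) ∧ ss: `e_p = p² − 1` EXACTLY**, every `𝔓 ∣ p`. With GEN 9 part 8 ((M), (G-ord) ⟹
`e_p = p − 1`) the column `e_p` of O8/SUBPARTITION-typed is theorem-level and EXACT on all three tame
cells at every odd `p` (at `p = 3`: `2 ∣ 2 ∣ 8`). [cite: Serre1972, §1.11 Prop. 12 c)]
[cite: Delbourgo1998, §1.5 (G)] -/
theorem O8.card_inertia_map_eq_sq_sub_one_of_subGss (hX : ClassX4 W p) (hG : SubGss W p)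
    {v : HeightOneSpectrum (𝓞 ℚ)} (hv : ((p : ℕ) : 𝓞 ℚ) ∈ v.asIdeal)
    {𝔓 : Ideal (absIntegers (𝓞 ℚ) ℚ)} (h𝔓 : 𝔓 ∈ v.primesAbove) :
    Nat.card ((𝔓.inertia (absoluteGaloisGroup ℚ)).map (galoisRepTorsion W p)) = p ^ 2 - 1 :=
  SubGss.card_inertia_map_eq_sq_sub_one W p hX.1 hX.2.1 hG hv h𝔓

omit [W.IsElliptic] [W.IsGloballyMinimal] in
/-- **(H.3) at level one from ANY element acting as `−1` on `E[p]`, `p` odd** (n1011-p04's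
`hH3_self_of_hasSurjectiveModNGaloisRep` with its only use of surjectivity — finding such an element —
turned into a hypothesis): every continuous crossed homomorphism `f : Γ_ℚ → E[p]` vanishing on
`ker ρ̄_{E,p} ∩ Gal(ℚ̄/ℚ(μ_p))` is principal (`−1` is central, `−1 − 1 = −2` is invertible on `E[p]`;
Sah's lemma `InflRes.h3_of_commute`). [cite: Sakamoto2024, §2 (H.3)] [cite: MazurRubin2004, Lemma 3.5.2] -/
theorem hH3_self_of_smul_eq_neg (hp2 : p ≠ 2) (z : absoluteGaloisGroup ℚ)
    (hz : ∀ P : geomTorsion W ((p : ℕ) : ℤ), z • P = -P)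
    (f : contOneCocycles (W.torsionGaloisModule ((p : ℕ) : ℤ)).toTopRep)
    (hf : ∀ u : absoluteGaloisGroup ℚ, (W.torsionGaloisModule ((p : ℕ) : ℤ)) u = 1 →
        u ∈ rootsOfUnityFixer ℚ p → f.1 u = 0) :
    oneCocycleClass (W.torsionGaloisModule ((p : ℕ) : ℤ)).toTopRep f = 0 := by
  have hp0 : p ≠ 0 := hp.out.ne_zero
  haveI : NeZero p := ⟨hp0⟩
  haveI : NeZero ((p : ℕ) : ℚ) := ⟨Nat.cast_ne_zero.mpr hp0⟩
  have hρz : (W.torsionGaloisModule ((p : ℕ) : ℤ)) z = -1 :=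
    LinearMap.ext fun x => by rw [torsionGaloisModule_apply_apply, hz]; rfl
  have htors : ∀ x : geomTorsion W ((p : ℕ) : ℤ), p • x = 0 := fun x => by
    have hx : ((p : ℕ) : ℤ) • (x : geomPoints W) = 0 := (Submodule.mem_torsionBy_iff _ _).mp x.2
    apply Subtype.ext
    rw [AddSubmonoidClass.coe_nsmul, ZeroMemClass.coe_zero, ← natCast_zsmul]
    exact hx
  refine InflRes.h3_of_commute (W.torsionGaloisModule ((p : ℕ) : ℤ))
    (W.torsionGaloisModule ((p : ℕ) : ℤ)) p z ?_ ?_ ?_ f hf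
  · intro g
    rw [hρz]
    exact Commute.neg_one_right _
  · intro g
    rw [hρz]
    exact Commute.neg_one_right _
  · exact InflRes.bijective_rho_sub_self_of_eq_neg (W.torsionGaloisModule ((p : ℕ) : ℤ)).toTopRep z
      (fun x => by change z • x = -x; exact hz x) p (hp.out.odd_of_ne_two hp2) htors

/-- **(H.3) at level one on EVERY `(G) ∧ ss` row at an odd `p`, surjective image or not**
(`SubGss W p`, `E` additive at `p`): the element acting as `−1` is taken in `I_𝔓` (§4), for any
`v ∋ p`, `𝔓 ∣ p` (they exist: `exists_ideal_placeOver`). [cite: Sakamoto2024, §2 (H.3)]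
[cite: Serre1972, §1.11 Prop. 12] [cite: Delbourgo1998, §1.5 (G)] -/
theorem SubGss.hH3_self (hp2 : p ≠ 2) (hadd : Addv W p) (hG : SubGss W p)
    (f : contOneCocycles (W.torsionGaloisModule ((p : ℕ) : ℤ)).toTopRep)
    (hf : ∀ u : absoluteGaloisGroup ℚ, (W.torsionGaloisModule ((p : ℕ) : ℤ)) u = 1 →
        u ∈ rootsOfUnityFixer ℚ p → f.1 u = 0) :
    oneCocycleClass (W.torsionGaloisModule ((p : ℕ) : ℤ)).toTopRep f = 0 := by
  have hp' : p.Prime := hp.out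
  -- the place `v` of `ℚ` at `p` and a prime `𝔓 ∣ p` of `ℤ̄`
  set v : HeightOneSpectrum (𝓞 ℚ) := primesEquiv.symm ⟨p, hp'⟩ with hvdef
  have hv : ((p : ℕ) : 𝓞 ℚ) ∈ v.asIdeal := (natCast_mem_asIdeal_iff_eq_primesEquiv_symm v hp').mpr rfl
  have hvp : (primesEquiv v : ℕ) = p := by rw [hvdef, Equiv.apply_symm_apply]
  obtain ⟨𝔓, -, h𝔓⟩ := exists_ideal_placeOver p hvp
  obtain ⟨z, -, hz⟩ := SubGss.exists_mem_inertia_smul_eq_neg W p hp2 hadd hG hv h𝔓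
  exact hH3_self_of_smul_eq_neg W p hp2 z hz f hf

/-- **O8 ∩ (G) ∧ ss: Sakamoto's (H.3) at level one WITHOUT surjectivity** (`ClassX4 W p`,
`SubGss W p`; no `Surj W p`, no `¬ Surj W p`): on the supersingular cell of O8 the Mazur–Rubin /
Sakamoto hypothesis (H.3) for `T = T̄ = E[p]` SURVIVES the loss of the big image — one line of the
joint small-image obstruction anatomy (O8 / N2 / N3) at theorem level. Nothing about (H.1), (H.2),
(H.4) or the core rank is claimed. [cite: Sakamoto2024, §2 (H.3)] [cite: Serre1972, §1.11 Prop. 12] -/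
theorem O8.hH3_self_of_subGss (hX : ClassX4 W p) (hG : SubGss W p)
    (f : contOneCocycles (W.torsionGaloisModule ((p : ℕ) : ℤ)).toTopRep)
    (hf : ∀ u : absoluteGaloisGroup ℚ, (W.torsionGaloisModule ((p : ℕ) : ℤ)) u = 1 →
        u ∈ rootsOfUnityFixer ℚ p → f.1 u = 0) :
    oneCocycleClass (W.torsionGaloisModule ((p : ℕ) : ℤ)).toTopRep f = 0 :=
  SubGss.hH3_self W p hX.1 hX.2.1 hG f hf

end Cell

end Summit.BirchSwinnertonDyer.Rank1Residual.GaloisImage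

end
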